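import Mathlib.Analysis.InnerProductSpace.PiL2
import Mathlib.Analysis.SpecialFunctions.Complex.Arg
import Mathlib.Analysis.SpecialFunctions.Trigonometric.Inverse
import Literature.Geometry.DiscreteGeometry.SphericalCodeContactGraph
import Literature.Geometry.DiscreteGeometry.KissingNodeDegree
import Summits.AtomisticToContinuum.Crystallization.Theses.TwoCentreKissingKernel
import HarnessLib

/-!
# `RobustTangencyBound` — robust local structure of a soft kissing shell (helper file)

Helper lemmas for item `stmt-AtomisticToContinuum-12082` (`RobustTangencyBound`, route
`TwoCentreKissingKernel`, sub-problem Crystallization): the first bricks of an EFFECTIVE version of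
the Flatley–Tarasov–Taylor–Theil 24-tangency classification, in the tolerance regime of the item
(norms in `[1 − η, 1 + η]`, separation `≥ 1 − η`, soft contacts `≤ 1 + η`).

* Part A (normalisation to the unit sphere, any real inner product space): for two points of the
  shell, the normalised vectors `x/‖x‖, y/‖y‖` have inner product `≤ 1/2 + 2η` (separation) and
  `≥ 1/2 − 3η` (soft contact), for `0 ≤ η ≤ 1/10`; normalisation moves a point by `≤ η` and is
  injective on the shell.
* Part B (robust vertex star, `ℝ³`): the interval version of Musin–Tarasov's degree bound
  (`Literature…no_six_neighbours`, exact contact level `κ`): if six unit vectors have inner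
  product with `v` in `[κ₁, κ₂]` (`0 ≤ κ₁ ≤ κ₂ < 1`) and pairwise inner products `≤ κ₂`, and
  `2(κ₂ − κ₁²) < 1 − κ₂²`, contradiction — consecutive tangent directions are `> π/3` apart.
  Hence (`card_softNbrs_le_five`) every point of a shell satisfying the hypotheses of
  `RobustTangencyBound` has at most five soft neighbours (the route's numbers:
  `κ₁ = 1/2 − 3η`, `κ₂ = 1/2 + 2η`, valid for `η ≤ 1/50`).
-/

noncomputable section

namespace Summit.AtomisticToContinuum.Crystallization.Theorems

open Real RealInnerProductSpace Literature.Geometry.DiscreteGeometry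

/-! ### Part A. Normalisation of a soft shell to the unit sphere -/

section NormOnly

variable {F : Type*} [NormedAddCommGroup F] [NormedSpace ℝ F]

omit [NormedSpace ℝ F] in
/-- A point of norm in `[1 − η, 1 + η]` with `η < 1` is nonzero. -/
theorem ne_zero_of_norm_mem {η : ℝ} (hη : η < 1) {x : F} (hx : 1 - η ≤ ‖x‖) : x ≠ 0 := by
  intro h; rw [h, norm_zero] at hx; linarith

/-- The normalised vector `x/‖x‖` of a nonzero vector is a unit vector. -/
theorem norm_normalise {x : F} (hx : x ≠ 0) : ‖‖x‖⁻¹ • x‖ = 1 := by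
  rw [norm_smul, norm_inv, norm_norm, inv_mul_cancel₀ (norm_ne_zero_iff.2 hx)]

/-- Normalisation moves a point of norm in `[1 − η, 1 + η]` by at most `η`:
`‖x/‖x‖ − x‖ = |1 − ‖x‖|`. -/
theorem dist_normalise_le {η : ℝ} (hη : η < 1) {x : F} (hx1 : 1 - η ≤ ‖x‖) (hx2 : ‖x‖ ≤ 1 + η) :
    dist (‖x‖⁻¹ • x) x ≤ η := by
  have hx0 : x ≠ 0 := ne_zero_of_norm_mem hη hx1
  have hn : 0 < ‖x‖ := norm_pos_iff.2 hx0
  have : ‖x‖⁻¹ • x - x = (‖x‖⁻¹ - 1) • x := by rw [sub_smul, one_smul]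
  rw [dist_eq_norm, this, norm_smul, Real.norm_eq_abs]
  have h1 : |‖x‖⁻¹ - 1| * ‖x‖ = |1 - ‖x‖| := by
    rw [← abs_of_pos hn, ← abs_mul, abs_of_pos hn, sub_mul, inv_mul_cancel₀ hn.ne', one_mul]
  rw [h1]
  rcases le_or_gt 1 ‖x‖ with h | h
  · rw [abs_of_nonpos (by linarith)]; linarith
  · rw [abs_of_pos (by linarith)]; linarith

end NormOnly

section Normalise

variable {F : Type*} [NormedAddCommGroup F] [InnerProductSpace ℝ F]

/-- The inner product of the normalised vectors in terms of norms and distance: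
`‖x‖ ‖y‖ ⟪x/‖x‖, y/‖y‖⟫ = (‖x‖² + ‖y‖² − ‖x − y‖²)/2`. -/
theorem norm_mul_norm_mul_inner_normalise {x y : F} (hx : x ≠ 0) (hy : y ≠ 0) :
    ‖x‖ * ‖y‖ * ⟪‖x‖⁻¹ • x, ‖y‖⁻¹ • y⟫ = (‖x‖ ^ 2 + ‖y‖ ^ 2 - ‖x - y‖ ^ 2) / 2 := by
  have ha : ‖x‖ ≠ 0 := norm_ne_zero_iff.2 hx
  have hb : ‖y‖ ≠ 0 := norm_ne_zero_iff.2 hy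
  have h1 : ‖x‖ * ‖y‖ * ⟪‖x‖⁻¹ • x, ‖y‖⁻¹ • y⟫ = ⟪x, y⟫ := by
    rw [real_inner_smul_left, real_inner_smul_right]
    field_simp
  rw [h1, norm_sub_sq_real]
  ring

/-- **Separation after normalisation.** Two points of the shell (norms in `[1 − η, 1 + η]`) at
distance `≥ 1 − η` normalise to unit vectors with inner product `≤ 1/2 + 2η` (`0 ≤ η ≤ 1/10`). -/
theorem inner_normalise_le_of_le_dist {η : ℝ} (hη0 : 0 ≤ η) (hη : η ≤ 1 / 10) {x y : F}
    (hx1 : 1 - η ≤ ‖x‖) (hx2 : ‖x‖ ≤ 1 + η) (hy1 : 1 - η ≤ ‖y‖) (hy2 : ‖y‖ ≤ 1 + η)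
    (hd : 1 - η ≤ dist x y) :
    ⟪‖x‖⁻¹ • x, ‖y‖⁻¹ • y⟫ ≤ 1 / 2 + 2 * η := by
  have hx0 : x ≠ 0 := ne_zero_of_norm_mem (by linarith) hx1
  have hy0 : y ≠ 0 := ne_zero_of_norm_mem (by linarith) hy1
  have ha : 0 < ‖x‖ := norm_pos_iff.2 hx0
  have hb : 0 < ‖y‖ := norm_pos_iff.2 hy0
  have key := norm_mul_norm_mul_inner_normalise hx0 hy0
  rw [dist_eq_norm] at hd
  have hd2 : (1 - η) ^ 2 ≤ ‖x - y‖ ^ 2 := pow_le_pow_left₀ (by linarith) hd 2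
  -- it suffices that `‖x‖² + ‖y‖² − (1 − η)² ≤ (1 + 4η) ‖x‖ ‖y‖`
  set a := ‖x‖ with ha'
  set b := ‖y‖ with hb'
  have hab : 0 < a * b := mul_pos ha hb
  have hA1 : 0 ≤ 1 + η - a := by linarith
  have hA2 : 0 ≤ a - (1 - η) := by linarith
  have hB1 : 0 ≤ 1 + η - b := by linarith
  have hB2 : 0 ≤ b - (1 - η) := by linarith
  have h5 : 0 ≤ 1 - 5 * η := by linarith
  have h2η : 0 ≤ 2 - η := by linarith
  -- `(1 + 4η) a b − a² − b² + (1 − η)²` is the nonnegative combination (`s = a − 1, t = b − 1`)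
  -- `(η−s)(η+s) + (η−t)(η+t) + (η−s)(η−t) + (1−5η)((η−s) + (η−t)) + 4η²(2−η)`
  -- `+ 2η[(s+η)(t+η) + (η−s)(η−t)]`.
  have hpoly : a ^ 2 + b ^ 2 - (1 - η) ^ 2 ≤ (1 + 4 * η) * (a * b) := by
    nlinarith [mul_nonneg hA1 hA2, mul_nonneg hB1 hB2, mul_nonneg hA1 hB1, mul_nonneg h5 hA1,
      mul_nonneg h5 hB1, mul_nonneg (mul_nonneg hη0 hη0) h2η,
      mul_nonneg hη0 (mul_nonneg hA2 hB2), mul_nonneg hη0 (mul_nonneg hA1 hB1)]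
  have h2 : a * b * ⟪a⁻¹ • x, b⁻¹ • y⟫ ≤ a * b * (1 / 2 + 2 * η) := by
    rw [key]; linarith [hd2, hpoly]
  exact le_of_mul_le_mul_left h2 hab

/-- **Soft contact after normalisation.** Two points of the shell at distance `≤ 1 + η`
normalise to unit vectors with inner product `≥ 1/2 − 3η` (`0 ≤ η ≤ 1/10`). -/
theorem le_inner_normalise_of_dist_le {η : ℝ} (hη0 : 0 ≤ η) (hη : η ≤ 1 / 10) {x y : F}
    (hx1 : 1 - η ≤ ‖x‖) (hx2 : ‖x‖ ≤ 1 + η) (hy1 : 1 - η ≤ ‖y‖) (hy2 : ‖y‖ ≤ 1 + η)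
    (hd : dist x y ≤ 1 + η) :
    1 / 2 - 3 * η ≤ ⟪‖x‖⁻¹ • x, ‖y‖⁻¹ • y⟫ := by
  have hx0 : x ≠ 0 := ne_zero_of_norm_mem (by linarith) hx1
  have hy0 : y ≠ 0 := ne_zero_of_norm_mem (by linarith) hy1
  have ha : 0 < ‖x‖ := norm_pos_iff.2 hx0
  have hb : 0 < ‖y‖ := norm_pos_iff.2 hy0
  have key := norm_mul_norm_mul_inner_normalise hx0 hy0
  rw [dist_eq_norm] at hd
  have hd2 : ‖x - y‖ ^ 2 ≤ (1 + η) ^ 2 := pow_le_pow_left₀ (norm_nonneg _) hd 2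
  set a := ‖x‖ with ha'
  set b := ‖y‖ with hb'
  have hab : 0 < a * b := mul_pos ha hb
  have hA1 : 0 ≤ 1 + η - a := by linarith
  have hA2 : 0 ≤ a - (1 - η) := by linarith
  have hB1 : 0 ≤ 1 + η - b := by linarith
  have hB2 : 0 ≤ b - (1 - η) := by linarith
  have h6 : 0 ≤ 1 + 6 * η := by linarith
  have hcub : 0 ≤ η * (2 - 13 * η - 6 * η ^ 2) := mul_nonneg hη0 (by nlinarith)
  have hpoly : (1 - 6 * η) * (a * b) ≤ a ^ 2 + b ^ 2 - (1 + η) ^ 2 := by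
    nlinarith [mul_nonneg h6 hA2, mul_nonneg h6 hB2, hcub, sq_nonneg (a - b), sq_nonneg (a - 1),
      sq_nonneg (b - 1), mul_nonneg hη0 (mul_nonneg hA2 hB2), mul_nonneg hη0 (mul_nonneg hA1 hB1)]
  have h2 : a * b * (1 / 2 - 3 * η) ≤ a * b * ⟪a⁻¹ • x, b⁻¹ • y⟫ := by
    rw [key]; linarith [hd2, hpoly]
  exact le_of_mul_le_mul_left h2 hab

/-- **Normalisation is injective on the shell**: two distinct points of norm in `[1 − η, 1 + η]`
at distance `≥ 1 − η` (`η < 1/3`) have distinct normalisations (collinear points of the shell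
would be within `2η < 1 − η` of each other). -/
theorem normalise_ne_of_le_dist {η : ℝ} (hη : η < 1 / 3) {x y : F}
    (hx1 : 1 - η ≤ ‖x‖) (hx2 : ‖x‖ ≤ 1 + η) (hy1 : 1 - η ≤ ‖y‖) (hy2 : ‖y‖ ≤ 1 + η)
    (hd : 1 - η ≤ dist x y) : ‖x‖⁻¹ • x ≠ ‖y‖⁻¹ • y := by
  intro h
  have hx0 : x ≠ 0 := ne_zero_of_norm_mem (by linarith) hx1
  have hy0 : y ≠ 0 := ne_zero_of_norm_mem (by linarith) hy1
  have ha : ‖x‖ ≠ 0 := norm_ne_zero_iff.2 hx0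
  have hb : ‖y‖ ≠ 0 := norm_ne_zero_iff.2 hy0
  have hx : x = ‖x‖ • (‖x‖⁻¹ • x) := by rw [smul_smul, mul_inv_cancel₀ ha, one_smul]
  have hy : y = ‖y‖ • (‖y‖⁻¹ • y) := by rw [smul_smul, mul_inv_cancel₀ hb, one_smul]
  have hx' : x = ‖x‖ • (‖y‖⁻¹ • y) := by rw [← h]; exact hx
  have hxy : x - y = (‖x‖ - ‖y‖) • (‖y‖⁻¹ • y) := by
    rw [sub_smul, ← hx', ← hy]
  have : dist x y = |‖x‖ - ‖y‖| := by
    rw [dist_eq_norm, hxy, norm_smul, norm_normalise hy0, mul_one, Real.norm_eq_abs]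
  rw [this] at hd
  have hle : |‖x‖ - ‖y‖| ≤ 2 * η := abs_sub_le_iff.2 ⟨by linarith, by linarith⟩
  linarith

end Normalise

/-! ### Part B. The robust vertex star: at most five soft neighbours -/

/-- Polar form with two radii: if `X² + Y² = R` and `X'² + Y'² = R'` then
`X X' + Y Y' = √R √R' cos (θ − θ')` with `θ, θ'` the arguments. -/
theorem mul_add_mul_eq_sqrt_mul_sqrt_mul_cos {X Y X' Y' R R' : ℝ} (h : X ^ 2 + Y ^ 2 = R)
    (h' : X' ^ 2 + Y' ^ 2 = R') :
    X * X' + Y * Y' =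
      √R * √R' * cos (Complex.arg ⟨X, Y⟩ - Complex.arg ⟨X', Y'⟩) := by
  set θ := Complex.arg ⟨X, Y⟩ with hθ
  set θ' := Complex.arg ⟨X', Y'⟩ with hθ'
  obtain ⟨hX, hY⟩ := eq_sqrt_mul_cos_sin_arg h
  obtain ⟨hX', hY'⟩ := eq_sqrt_mul_cos_sin_arg h'
  rw [← hθ] at hX hY
  rw [← hθ'] at hX' hY'
  rw [hX, hY, hX', hY', cos_sub]
  ring

/-- **No six soft neighbours (interval form of Musin–Tarasov, Proposition 3.3).** Let `v` be a
unit vector of `ℝ³`, `0 ≤ κ₁ ≤ κ₂ < 1` with `2(κ₂ − κ₁²) < 1 − κ₂²`, and `u₀, …, u₅` six unit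
vectors with `⟪v, uₖ⟫ ∈ [κ₁, κ₂]` and `⟪uᵢ, uⱼ⟫ ≤ κ₂` for `i ≠ j`.  Contradiction: in a frame
with third vector `v`, `uₖ = (Xₖ, Yₖ, zₖ)` with `Xₖ² + Yₖ² = 1 − zₖ² ≥ 1 − κ₂²`, and
`⟪uᵢ, uⱼ⟫ = √(1−zᵢ²) √(1−zⱼ²) cos(θᵢ − θⱼ) + zᵢ zⱼ ≤ κ₂` with `zᵢ zⱼ ≥ κ₁²` forces
`cos(θᵢ − θⱼ) < 1/2`; six directions pairwise `> π/3` apart do not fit round a circle. -/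
theorem no_six_soft_neighbours {v : EuclideanSpace ℝ (Fin 3)} (hv : ‖v‖ = 1) {κ₁ κ₂ : ℝ}
    (hκ₀ : 0 ≤ κ₁) (hκ₁₂ : κ₁ ≤ κ₂) (hκ₂ : κ₂ < 1) (hgap : 2 * (κ₂ - κ₁ ^ 2) < 1 - κ₂ ^ 2)
    (u : Fin 6 → EuclideanSpace ℝ (Fin 3)) (hn : ∀ k, ‖u k‖ = 1)
    (hc₁ : ∀ k, κ₁ ≤ ⟪v, u k⟫) (hc₂ : ∀ k, ⟪v, u k⟫ ≤ κ₂)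
    (hsep : ∀ i j, i ≠ j → ⟪u i, u j⟫ ≤ κ₂) : False := by
  obtain ⟨b, hb⟩ := exists_orthonormalBasis_third_eq_unit hv
  set X : Fin 6 → ℝ := fun k => ⟪b 0, u k⟫ with hXdef
  set Y : Fin 6 → ℝ := fun k => ⟪b 1, u k⟫ with hYdef
  set Z : Fin 6 → ℝ := fun k => ⟪b 2, u k⟫ with hZdef
  have hZ : ∀ k, Z k = ⟪v, u k⟫ := fun k => by simp only [hZdef, hb]
  set R : Fin 6 → ℝ := fun k => 1 - Z k ^ 2 with hRdef
  have hXY : ∀ k, X k ^ 2 + Y k ^ 2 = R k := by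
    intro k
    have h1 : ⟪u k, u k⟫ = 1 := by
      rw [real_inner_self_eq_norm_sq, hn k]; norm_num
    rw [inner_eq_sum_three b] at h1
    simp only [hXdef, hYdef, hRdef, hZdef]
    nlinarith [h1]
  have hZ1 : ∀ k, κ₁ ≤ Z k := fun k => by rw [hZ k]; exact hc₁ k
  have hZ2 : ∀ k, Z k ≤ κ₂ := fun k => by rw [hZ k]; exact hc₂ k
  have hRlo : ∀ k, 1 - κ₂ ^ 2 ≤ R k := by
    intro k
    have h0 : 0 ≤ Z k := (hκ₀.trans (hZ1 k))
    simp only [hRdef]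
    nlinarith [hZ2 k, h0]
  have hpos : 0 < 1 - κ₂ ^ 2 := by nlinarith
  have hsq : ∀ k, √(1 - κ₂ ^ 2) ≤ √(R k) := fun k => Real.sqrt_le_sqrt (hRlo k)
  have hs0 : 0 < √(1 - κ₂ ^ 2) := Real.sqrt_pos.2 hpos
  have hss : √(1 - κ₂ ^ 2) * √(1 - κ₂ ^ 2) = 1 - κ₂ ^ 2 := Real.mul_self_sqrt hpos.le
  set θ : Fin 6 → ℝ := fun k => Complex.arg ⟨X k, Y k⟩ with hθdef
  have hinner : ∀ i j, ⟪u i, u j⟫ = √(R i) * √(R j) * cos (θ i - θ j) + Z i * Z j := by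
    intro i j
    have hcs := mul_add_mul_eq_sqrt_mul_sqrt_mul_cos (hXY i) (hXY j)
    rw [inner_eq_sum_three b]
    simp only [hθdef]
    linarith [hcs]
  -- the pairwise constraints: `cos (θ i - θ j) < 1/2`
  have hC : ∀ i j, i ≠ j → cos (θ i - θ j) < 1 / 2 := by
    intro i j hij
    have h1 := hsep i j hij
    rw [hinner i j] at h1
    have hzz : κ₁ ^ 2 ≤ Z i * Z j := by
      have := mul_le_mul (hZ1 i) (hZ1 j) hκ₀ (hκ₀.trans (hZ1 i))
      nlinarith [this]
    by_contra hge
    push Not at hge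
    -- `√Rᵢ √Rⱼ cos ≥ (1 − κ₂²)/2 > κ₂ − κ₁²`
    have hprod : 1 - κ₂ ^ 2 ≤ √(R i) * √(R j) := by
      rw [← hss]
      exact mul_le_mul (hsq i) (hsq j) hs0.le ((hs0.le).trans (hsq i))
    have : (1 - κ₂ ^ 2) * (1 / 2) ≤ √(R i) * √(R j) * cos (θ i - θ j) :=
      mul_le_mul hprod hge (by norm_num) (hpos.le.trans hprod)
    linarith
  have hθinj : Function.Injective θ := by
    intro i j hij
    by_contra hne
    have := hC i j hne
    rw [hij, sub_self, cos_zero] at this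
    linarith
  -- sort the six angles
  have hAcard : (Finset.univ.image θ).card = 6 := by
    rw [Finset.card_image_of_injective _ hθinj, Finset.card_univ, Fintype.card_fin]
  let e := (Finset.univ.image θ).orderEmbOfFin hAcard
  have hmem : ∀ k, ∃ i, θ i = e k := by
    intro k
    have := (Finset.univ.image θ).orderEmbOfFin_mem hAcard k
    rw [Finset.mem_image] at this
    obtain ⟨i, -, hi⟩ := this
    exact ⟨i, hi⟩
  choose π' hπ' using hmem
  refine six_sorted_angles_false (fun k => e k) e.strictMono ?_ ?_ ?_
  · show -π < e 0
    rw [← hπ' 0]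
    exact Complex.neg_pi_lt_arg _
  · show e 5 ≤ π
    rw [← hπ' 5]
    exact Complex.arg_le_pi _
  · intro i j hij
    have hne : π' i ≠ π' j := by
      intro h
      apply hij
      apply e.injective
      rw [← hπ' i, ← hπ' j, h]
    rw [← hπ' i, ← hπ' j]
    exact hC _ _ hne

/-- **At most five soft neighbours (finite-set form).** If every point of the finite set `N` of
unit vectors of `ℝ³` has inner product in `[κ₁, κ₂]` with the unit vector `v`
(`0 ≤ κ₁ ≤ κ₂ < 1`, `2(κ₂ − κ₁²) < 1 − κ₂²`), and any two distinct points of `N` have inner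
product `≤ κ₂`, then `|N| ≤ 5`. -/
theorem card_le_five_of_soft_neighbours {v : EuclideanSpace ℝ (Fin 3)} (hv : ‖v‖ = 1)
    {κ₁ κ₂ : ℝ} (hκ₀ : 0 ≤ κ₁) (hκ₁₂ : κ₁ ≤ κ₂) (hκ₂ : κ₂ < 1)
    (hgap : 2 * (κ₂ - κ₁ ^ 2) < 1 - κ₂ ^ 2) {N : Finset (EuclideanSpace ℝ (Fin 3))}
    (hn : ∀ u ∈ N, ‖u‖ = 1) (hc₁ : ∀ u ∈ N, κ₁ ≤ ⟪v, u⟫) (hc₂ : ∀ u ∈ N, ⟪v, u⟫ ≤ κ₂)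
    (hsep : ∀ u ∈ N, ∀ w ∈ N, u ≠ w → ⟪u, w⟫ ≤ κ₂) : N.card ≤ 5 := by
  by_contra h
  obtain ⟨N', hN', hcard⟩ := Finset.exists_subset_card_eq (show 6 ≤ N.card by omega)
  set e := (Finset.equivFinOfCardEq hcard).symm with he
  refine no_six_soft_neighbours hv hκ₀ hκ₁₂ hκ₂ hgap
    (fun k => ((e k : N') : EuclideanSpace ℝ (Fin 3)))
    (fun k => hn _ (hN' (e k).2)) (fun k => hc₁ _ (hN' (e k).2)) (fun k => hc₂ _ (hN' (e k).2))
    fun i j hij => hsep _ (hN' (e i).2) _ (hN' (e j).2) ?_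
  exact fun h => hij (e.injective (Subtype.val_injective h))

/-- The route's numbers satisfy the gap condition: for `0 ≤ η ≤ 1/50`, with `κ₁ = 1/2 − 3η` and
`κ₂ = 1/2 + 2η` one has `0 ≤ κ₁ ≤ κ₂ < 1` and `2(κ₂ − κ₁²) < 1 − κ₂²` (`12η + 14η² < 1/4`). -/
theorem soft_gap_numbers {η : ℝ} (hη0 : 0 ≤ η) (hη : η ≤ 1 / 50) :
    0 ≤ 1 / 2 - 3 * η ∧ 1 / 2 - 3 * η ≤ 1 / 2 + 2 * η ∧ 1 / 2 + 2 * η < 1 ∧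
      2 * (1 / 2 + 2 * η - (1 / 2 - 3 * η) ^ 2) < 1 - (1 / 2 + 2 * η) ^ 2 := by
  refine ⟨by linarith, by linarith, by linarith, ?_⟩
  nlinarith

/-- **Every point of a soft kissing shell has at most five soft neighbours.** Let `T` be a finite
set of points of a real inner product space… specialised to `ℝ³`: norms in `[1 − η, 1 + η]`,
pairwise distances `≥ 1 − η`, `0 ≤ η ≤ 1/50`. Then for every `t ∈ T` at most five other points of
`T` are within distance `1 + η` of `t` (normalise to the unit sphere and apply
`card_le_five_of_soft_neighbours` with `κ₁ = 1/2 − 3η`, `κ₂ = 1/2 + 2η`). -/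
theorem card_softNbrs_le_five {η : ℝ} (hη0 : 0 ≤ η) (hη : η ≤ 1 / 50)
    {T : Finset (EuclideanSpace ℝ (Fin 3))}
    (hnorm : ∀ y ∈ T, 1 - η ≤ ‖y‖ ∧ ‖y‖ ≤ 1 + η)
    (hsep : ∀ y ∈ T, ∀ y' ∈ T, y ≠ y' → 1 - η ≤ dist y y') :
    ∀ t ∈ T, (T.filter fun t' => t' ≠ t ∧ dist t t' ≤ 1 + η).card ≤ 5 := by
  classical
  intro t ht
  obtain ⟨h1, h2, h3, h4⟩ := soft_gap_numbers hη0 hη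
  have hη' : η ≤ 1 / 10 := by linarith
  set S := T.filter fun t' => t' ≠ t ∧ dist t t' ≤ 1 + η with hS
  -- normalise
  let nr : EuclideanSpace ℝ (Fin 3) → EuclideanSpace ℝ (Fin 3) := fun x => ‖x‖⁻¹ • x
  have hinj : Set.InjOn nr ↑S := by
    intro x hx y hy hxy
    rw [Finset.coe_filter, Set.mem_setOf_eq] at hx hy
    by_contra hne
    exact normalise_ne_of_le_dist (by linarith) (hnorm x hx.1).1 (hnorm x hx.1).2
      (hnorm y hy.1).1 (hnorm y hy.1).2 (hsep x hx.1 y hy.1 hne) hxy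
  rw [← Finset.card_image_of_injOn hinj]
  have ht0 : t ≠ 0 := ne_zero_of_norm_mem (by linarith) (hnorm t ht).1
  refine card_le_five_of_soft_neighbours (v := nr t) (norm_normalise ht0) h1 h2 h3 h4
    ?_ ?_ ?_ ?_
  · intro u hu
    obtain ⟨x, hx, rfl⟩ := Finset.mem_image.1 hu
    rw [Finset.mem_filter] at hx
    exact norm_normalise (ne_zero_of_norm_mem (by linarith) (hnorm x hx.1).1)
  · intro u hu
    obtain ⟨x, hx, rfl⟩ := Finset.mem_image.1 hu
    rw [Finset.mem_filter] at hx
    exact le_inner_normalise_of_dist_le hη0 hη' (hnorm t ht).1 (hnorm t ht).2 (hnorm x hx.1).1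
      (hnorm x hx.1).2 hx.2.2
  · intro u hu
    obtain ⟨x, hx, rfl⟩ := Finset.mem_image.1 hu
    rw [Finset.mem_filter] at hx
    exact inner_normalise_le_of_le_dist hη0 hη' (hnorm t ht).1 (hnorm t ht).2 (hnorm x hx.1).1
      (hnorm x hx.1).2 (hsep t ht x hx.1 (Ne.symm hx.2.1))
  · intro u hu w hw huw
    obtain ⟨x, hx, rfl⟩ := Finset.mem_image.1 hu
    obtain ⟨y, hy, rfl⟩ := Finset.mem_image.1 hw
    rw [Finset.mem_filter] at hx hy
    have hxy : x ≠ y := fun h => huw (by rw [h])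
    exact inner_normalise_le_of_le_dist hη0 hη' (hnorm x hx.1).1 (hnorm x hx.1).2 (hnorm y hy.1).1
      (hnorm y hy.1).2 (hsep x hx.1 y hy.1 hxy)

end Summit.AtomisticToContinuum.Crystallization.Theorems

end
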